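/-
COR-CM (cell pub-hodgecm2, stage 2 of the Hodge ladder) — count-neutral KERNEL CENSUS TRANSPORT «the MARKMAN COLUMN», degree 12, type
`ℤ/6×ℤ/2` (`c = (3,0)`) — certificates, enlarged generation binder and FIELD CLOSURE (seat prover-pub-hodgecm2-b23-g34-0, binder prover b23, gen 34; own lane DEG12-MARKMAN-TRANSPORT,
HOME/LIT-CLAIMS.md l.1451, HOME/INBOX.md l.5632; seat b07's ORBIT-COUNT v2 §7.3/§7.4 offer by adjacency; sequel of
`Census/DuodecicFaceTransportC6C2.lean` (b23) on seat b09's DECIC-MARKMAN pattern `Census/DecicFaceTransportOfMarkman.lean`, generic part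
`CorCM/FaceCensusMarkmanColumn.lean`).  Theorems only; no definition, no named fact, nothing asserted; the census data `Γ` of
`Census/DuodecicFaceGeneratorsC6C2.lean` BY NAME; `Interfaces.lean` (C1), every E term, `B01/*`, `Transposition/*` untouched.
HONEST FRAMING (COORDINATOR RULING — HODGE FRAMING CORRECTION, 2026-08-21T11:55:35Z): `HC_CM` is NOT proved, here or anywhere in the
tree; nothing here produces a period or proves a case of the Hodge conjecture.
T5 (coordinator ruling 15:33:56Z (3)): binder set of §4 = b23's landed `…_duodecicC6C2` set {dictionary (e, hmul, hconj), face readings,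
face periods} MINUS 1 face period(s) PLUS {type readings of `E₀`, `T₁` (inhabited:
`FaceCensus.exists_type_reads`), `hHC` ×1 (instances of the Hodge conjecture on tree abelian varieties; no `¬` theorem in the tree; supplied
modulo `Markman2025_weilClasses_algebraic_abelianFourfold` by seat b07's `CorCM/InducedCurveThreefoldHodgeOfMarkman.lean` once the types are
presented as induced types — NOT done in this file)}; no contradiction derivable; checker: self (prover-pub-hodgecm2-b23-g34-0), 2026-08-21.
-/
import Summits.HodgeConjecture.CorCM.Census.DuodecicFaceTransportC6C2
import Summits.HodgeConjecture.CorCM.FaceCensusMarkmanColumn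
import Summits.HodgeConjecture.CorCM.FacePeriodsKnownProducts
import HarnessLib

/-!
# Degree 12, type `ℤ/6×ℤ/2` (`c = (3,0)`): 5 face periods + the Markman FOURFOLD column close the slice (census transport)

Seat b23's `DuodecicFaceTransport.C6C2.hodgeConjectureFor_of_avDominatedBy_isProductOf_of_facePeriod_duodecicC6C2` closes this slice of
the Hodge conjecture from period witnesses on 6 faces reading as the generating representatives `(455;9,18)`, `(455;9,36)`, `(455;9,1152)`, `(462;18,2304)`, `(462;36,1152)`, `(469;9,1152)`.
Here 1 of them (`(469;9,1152)`) are replaced by KNOWN PRODUCTS — the Weil-fourfold families `E_a × T` of seat b07's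
ORBIT-COUNT v2 §7 (HOME/pub-hodgecm2-b07/ORBIT-COUNT.md), read on the tree as Hodge weights of degree `2` on two-slot families `![E_a, T]` of
CM types of `K` given by their codes at `σ₀`:

* `E₀` READS AS `1365`: the type of `K` induced from the type `{σ₀|_{k₀}}` of the imaginary quadratic subfield `k₀ = K^{2ℤ/6 × ℤ/2}` (mask `1365` = `Gal(K/k₀) = {0,2,4,6,8,10}`, indices `i ↔ (i % 6, i / 6)`)
* `T₁` READS AS `3640`: induced from the CYCLIC sextic CM subfield `L₀ = K^{⟨(0,1)⟩}` (cosets `{(a,0),(a,1)}`, `a ∈ {3,4,5}`, mask `3640`; a threefold type NOT induced from `k₀ ⊂ L₀`)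

(weight(s) `W₁` on `![E₀, T₁]` = codes `(1365, 3640)`, slots `[0]`, `[4, 2, 0]` (labels `[910, 1365, 2275, 3640]`)).  §1: the certificate(s) — closed kernel identities over the 64 CM-type codes (`decide`) — with their side checks and the Hodge check of the weight(s); §2: unwound into `weightRel f.corner (· ↦ {σ₀}) ∈ span ℤ Y(𝒮, 𝒲) ⊔ pairRel` (`FaceCensus.mem_of_eval_eq_comboVal`, `weightRel_pair_apply`, `mem_known_of_sub_mem`).  §3: b23's binder `hgen_duodecicC6C2`, applied to `𝒮` enlarged by faces reading as the dropped
representatives (they exist: `FaceCensus.exists_face_reads`), with those faces eliminated at every base embedding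
(`FaceCensus.lefChar_corner_mem_closure_known_of_weightRel_mem`, seat b09), gives the ENLARGED generation binder; §4
(`hodgeConjectureFor_of_avDominatedBy_isProductOf_of_exists_facePeriod_of_hodgeConjectureFor_on`, seat b09's `CorCM/FacePeriodsKnownProducts.lean`):

  period witnesses on the 5 faces `(455;9,18)`, `(455;9,36)`, `(455;9,1152)`, `(462;18,2304)`, `(462;36,1152)` of `K` + `HodgeConjectureFor` of the 1 tree products
  `cmProdAV K cmAbelianVarietyRealised_holds 1 ![E_a, T]`
    ⟹ the Hodge conjecture, in every codimension, for every abelian variety dominated by a product of realisations of CM types of CM fields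
      embeddable in `K`.

LATTICE FACTS (exact model, seat folder `work/markman_d6.py`, `minfam.py`): the corner vectors of the kept cells and the 32 divisor pairs span a
sublattice of corank 2 of the rank-58 Pohlmann–Hodge lattice; with the twelve Weil-fourfold monomials the span is everything (index 1); FOUR of
them suffice for the dropped representatives and no three do.  By seat b17's kernel bound `five_le_card_of_generates` (`Census/DodecicC6C2Minimality.lean`) five orbits is optimal for `ℤ/6×ℤ/2`.
`HC_CM` is NOT proved; no period is produced here.

References: [cite: Pohlmann1968, Thm. 1]; [cite: Milne1999LefschetzClasses, Thm. 3.2 and Cor. 4.5]; [cite: Shimura1998, §6.2 Theorem 3 and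
§6.1 Corollary of Theorem 2 (pp. 41–43)]; [cite: MumfordAV1970, §19 Thm. 1 and p. 169]; [cite: Markman2025SurveySecant, Thm. 1.2] (only through
the hypotheses `hHC`).
-/

noncomputable section

open CategoryTheory NumberField NumberField.ComplexEmbedding
open Literature.AlgebraicGeometry Literature.AlgebraicGeometry.Motives Literature.AlgebraicGeometry.HodgeTheory
open Literature.AlgebraicGeometry.ComplexMultiplication Literature.AlgebraicGeometry.Milne1999
open Literature.NumberTheory.Automorphic Literature.NumberTheory.Automorphic.PicardCM
open Literature.NumberTheory.ComplexMultiplication.CMTypeOps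
open Summit.HodgeConjecture.CorCM.Prior.AllgGroup.RfwfAllgGroup
open Summit.HodgeConjecture.CorCM.Census.FaceSquaresModel
open Summit.HodgeConjecture.CorCM.Census.DuodecicFaceGeneratorsC6C2 (Γ)
open Summit.HodgeConjecture.CorCM.DuodecicFaceTransport.C6C2 (hgen_duodecicC6C2)
open Summit.HodgeConjecture.CorCM.FaceCensus
open Summit.HodgeConjecture.CorCM.Domination

namespace Summit.HodgeConjecture.CorCM.DuodecicFaceTransport.C6C2Markman

/-! ## §1 The certificate(s), side checks, Hodge check(s) of the weight(s) -/

/-- **CERTIFICATE for the dropped representative `(469;9,1152)`** (corners `[469, 3619, 2730, 1372]`): `1_{corners}` minus the listed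
multiples of the 1 Weil-fourfold weight relation(s) equals b30's `comboVal` of 7 corner vectors of faces in the kept orbit cells and 2 divisor
pairs, at every CM-type code (closed kernel identity). [folklore] -/
theorem cert_R₆ : ∀ S ∈ Γ.cmTypes,
    (if (Γ.corners (469, 9, 1152)).contains S then (1 : ℤ) else 0) -
        ((-1 : ℤ) * ((([0] : List (Fin 12)).map fun u => if S = Γ.twist u 1365 then (1 : ℤ) else 0).sum + (([4, 2, 0] : List (Fin 12)).map fun u => if S = Γ.twist u 3640 then (1 : ℤ) else 0).sum)) =
      Γ.comboVal [((3619, 18, 9), 1), ((1372, 36, 576), 1), ((483, 9, 36), -1), ((3192, 2304, 576), -1), ((3605, 9, 1152), 1), ((2716, 2304, 9), -1),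
        ((910, 9, 18), 1)]
        [(455, 1), (1365, 1)] S := by
  decide +kernel

/-- Side checks of `cert_R₆`: every generator face lies in an eight-face orbit cell of a Galois twist of a KEPT representative, and every
pair label is a CM type of the model (closed). [folklore] -/
theorem checks_R₆ :
    (([((3619, 18, 9), 1), ((1372, 36, 576), 1), ((483, 9, 36), -1), ((3192, 2304, 576), -1), ((3605, 9, 1152), 1), ((2716, 2304, 9), -1),
        ((910, 9, 18), 1)] : List ((ℕ × ℕ × ℕ) × ℤ)).all fun gi => ([(455, 9, 18), (455, 9, 36), (455, 9, 1152), (462, 18, 2304), (462, 36, 1152)] : List (ℕ × ℕ × ℕ)).any fun r => (List.finRange 12).any fun j =>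
      [(Γ.twist j r.1, Γ.twist j r.2.1, Γ.twist j r.2.2),
        (flipAt (Γ.twist j r.2.1) (Γ.twist j r.1), Γ.twist j r.2.1, Γ.twist j r.2.2),
        (flipAt (Γ.twist j r.2.2) (Γ.twist j r.1), Γ.twist j r.2.1, Γ.twist j r.2.2),
        (flipAt (Γ.twist j r.2.2) (flipAt (Γ.twist j r.2.1) (Γ.twist j r.1)), Γ.twist j r.2.1, Γ.twist j r.2.2),
        (Γ.twist j r.1, Γ.twist j r.2.2, Γ.twist j r.2.1),
        (flipAt (Γ.twist j r.2.1) (Γ.twist j r.1), Γ.twist j r.2.2, Γ.twist j r.2.1),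
        (flipAt (Γ.twist j r.2.2) (Γ.twist j r.1), Γ.twist j r.2.2, Γ.twist j r.2.1),
        (flipAt (Γ.twist j r.2.2) (flipAt (Γ.twist j r.2.1) (Γ.twist j r.1)), Γ.twist j r.2.2, Γ.twist j r.2.1)].contains gi.1)
      = true ∧
    (([(455, 1), (1365, 1)] : List (ℕ × ℤ)).all fun pj => Γ.isCMType pj.1) = true := by
  constructor <;> decide +kernel

/-- Hodge check of the weight `W₁` (codes `(1365, 3640)`, slots `[0]`, `[4, 2, 0]`; labels `[910, 1365, 2275, 3640]`): duplicate-free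
slots of total size `4` and every Galois translate of type `(2,2)` (closed). [cite: Pohlmann1968, Thm. 1] -/
theorem hodgeCheck_W₁ : (([0] : List (Fin 12)).Nodup ∧ ([4, 2, 0] : List (Fin 12)).Nodup) ∧
    ([0] : List (Fin 12)).length + ([4, 2, 0] : List (Fin 12)).length = 2 * 2 ∧
    ∀ i : Fin 12, (([0] : List (Fin 12)).map fun u => if mem i (Γ.twist u 1365) = true then (1 : ℤ) else 0).sum +
      (([4, 2, 0] : List (Fin 12)).map fun u => if mem i (Γ.twist u 3640) = true then (1 : ℤ) else 0).sum = (2 : ℕ) := by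
  refine ⟨by decide, by decide, ?_⟩
  decide

/-! ## §2 The certificates unwound: the dropped faces lie in the enlarged module -/

section Model

variable {F : Type} [Field F] [NumberField F] [IsGalois ℚ F] (e : GalT F ≃ Fin 12)

/-- The KEPT representatives are read in `𝒮` (the `hreps` clause of `FaceCensus.mem_of_eval_eq_comboVal`). [folklore] -/
theorem hreps_kept (σ₀ : F →+* ℂ) (𝒮 : Set (Face F)) (R₁ R₂ R₃ R₄ R₅ : Face F)
    (hR₁S : R₁ ∈ 𝒮) (hR₂S : R₂ ∈ 𝒮) (hR₃S : R₃ ∈ 𝒮) (hR₄S : R₄ ∈ 𝒮) (hR₅S : R₅ ∈ 𝒮)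
    (hR₁ : (∀ P : GalT F, P.1 σ₀ ∈ R₁.Φ.1 ↔ mem (e P) 455 = true) ∧
      Γ.placeMask (e (translate σ₀ R₁.p)) = 9 ∧ Γ.placeMask (e (translate σ₀ R₁.p')) = 18)
    (hR₂ : (∀ P : GalT F, P.1 σ₀ ∈ R₂.Φ.1 ↔ mem (e P) 455 = true) ∧
      Γ.placeMask (e (translate σ₀ R₂.p)) = 9 ∧ Γ.placeMask (e (translate σ₀ R₂.p')) = 36)
    (hR₃ : (∀ P : GalT F, P.1 σ₀ ∈ R₃.Φ.1 ↔ mem (e P) 455 = true) ∧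
      Γ.placeMask (e (translate σ₀ R₃.p)) = 9 ∧ Γ.placeMask (e (translate σ₀ R₃.p')) = 1152)
    (hR₄ : (∀ P : GalT F, P.1 σ₀ ∈ R₄.Φ.1 ↔ mem (e P) 462 = true) ∧
      Γ.placeMask (e (translate σ₀ R₄.p)) = 18 ∧ Γ.placeMask (e (translate σ₀ R₄.p')) = 2304)
    (hR₅ : (∀ P : GalT F, P.1 σ₀ ∈ R₅.Φ.1 ↔ mem (e P) 462 = true) ∧
      Γ.placeMask (e (translate σ₀ R₅.p)) = 36 ∧ Γ.placeMask (e (translate σ₀ R₅.p')) = 1152) :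
    ∀ r ∈ ([(455, 9, 18), (455, 9, 36), (455, 9, 1152), (462, 18, 2304), (462, 36, 1152)] : List (ℕ × ℕ × ℕ)), ∃ R ∈ 𝒮, (r.1 < 2 ^ 12 ∧ ∀ i : Fin 12, mem i r.1 = true ↔ e.symm i ∈ (pullType R.Φ σ₀).1) ∧
      Γ.placeMask (e (translate σ₀ R.p)) = r.2.1 ∧ Γ.placeMask (e (translate σ₀ R.p')) = r.2.2 := by
  intro r hr
  simp only [List.mem_cons, List.not_mem_nil, or_false] at hr
  rcases hr with rfl | rfl | rfl | rfl | rfl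
  · exact hreps_of_reads Γ e σ₀ 𝒮 hR₁S (by norm_num) hR₁
  · exact hreps_of_reads Γ e σ₀ 𝒮 hR₂S (by norm_num) hR₂
  · exact hreps_of_reads Γ e σ₀ 𝒮 hR₃S (by norm_num) hR₃
  · exact hreps_of_reads Γ e σ₀ 𝒮 hR₄S (by norm_num) hR₄
  · exact hreps_of_reads Γ e σ₀ 𝒮 hR₅S (by norm_num) hR₅

open scoped Classical in
/-- **The dropped face `(469;9,1152)` lies in the enlarged module** (pre-quotient, at the base embedding): for a face `R` of `F` reading as
`(469;9,1152)` at `σ₀` (code form), any `𝒮` containing faces reading as the kept representatives and any `𝒲` containing the families of the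
weights used by `cert_R₆`:  `weightRel R.corner (· ↦ {σ₀}) ∈ span ℤ Y(𝒮, 𝒲) ⊔ pairRel`. [cite: Pohlmann1968, Thm. 1] -/
theorem weightRel_R₆_mem_span_known (hmul : ∀ P Q : GalT F, e (P * Q) = Γ.mul (e P) (e Q)) (hconj : e conjT = Γ.conj)
    (σ₀ : F →+* ℂ) (𝒮 : Set (Face F)) (𝒲 : Set ((m : ℕ) × (Fin (m + 1) → CMType F))) (R₁ R₂ R₃ R₄ R₅ : Face F)
    (hR₁S : R₁ ∈ 𝒮) (hR₂S : R₂ ∈ 𝒮) (hR₃S : R₃ ∈ 𝒮) (hR₄S : R₄ ∈ 𝒮) (hR₅S : R₅ ∈ 𝒮)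
    (hR₁ : (∀ P : GalT F, P.1 σ₀ ∈ R₁.Φ.1 ↔ mem (e P) 455 = true) ∧
      Γ.placeMask (e (translate σ₀ R₁.p)) = 9 ∧ Γ.placeMask (e (translate σ₀ R₁.p')) = 18)
    (hR₂ : (∀ P : GalT F, P.1 σ₀ ∈ R₂.Φ.1 ↔ mem (e P) 455 = true) ∧
      Γ.placeMask (e (translate σ₀ R₂.p)) = 9 ∧ Γ.placeMask (e (translate σ₀ R₂.p')) = 36)
    (hR₃ : (∀ P : GalT F, P.1 σ₀ ∈ R₃.Φ.1 ↔ mem (e P) 455 = true) ∧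
      Γ.placeMask (e (translate σ₀ R₃.p)) = 9 ∧ Γ.placeMask (e (translate σ₀ R₃.p')) = 1152)
    (hR₄ : (∀ P : GalT F, P.1 σ₀ ∈ R₄.Φ.1 ↔ mem (e P) 462 = true) ∧
      Γ.placeMask (e (translate σ₀ R₄.p)) = 18 ∧ Γ.placeMask (e (translate σ₀ R₄.p')) = 2304)
    (hR₅ : (∀ P : GalT F, P.1 σ₀ ∈ R₅.Φ.1 ↔ mem (e P) 462 = true) ∧
      Γ.placeMask (e (translate σ₀ R₅.p)) = 36 ∧ Γ.placeMask (e (translate σ₀ R₅.p')) = 1152)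
    (R : Face F) (hR : (469 < 2 ^ 12 ∧ ∀ i : Fin 12, mem i 469 = true ↔ e.symm i ∈ (pullType R.Φ σ₀).1) ∧
      Γ.placeMask (e (translate σ₀ R.p)) = 9 ∧ Γ.placeMask (e (translate σ₀ R.p')) = 1152)
    (E₀ T₁ : CMType F)
    (hE₀ : (∀ P : GalT F, P.1 σ₀ ∈ E₀.1 ↔ mem (e P) 1365 = true))
    (hT₁ : (∀ P : GalT F, P.1 σ₀ ∈ T₁.1 ↔ mem (e P) 3640 = true))
    (hW₁ : (⟨1, ![E₀, T₁]⟩ : (m : ℕ) × (Fin (m + 1) → CMType F)) ∈ 𝒲) :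
    weightRel R.corner (fun _ => ({σ₀} : Finset (F →+* ℂ))) ∈
      Submodule.span ℤ {y : CMF (GalT F) conjT →₀ ℤ |
        (∃ g ∈ 𝒮, ∃ σ : F →+* ℂ, y = weightRel g.corner (fun _ => ({σ} : Finset (F →+* ℂ)))) ∨
        ∃ w ∈ 𝒲, ∃ (p' : ℕ) (S' : Fin (w.1 + 1) → Finset (F →+* ℂ)), IsHodgeWeight w.2 p' S' ∧ y = weightRel w.2 S'}
        ⊔ pairRel := by
  have hxy : weightRel R.corner (fun _ => ({σ₀} : Finset (F →+* ℂ))) -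
      ((-1 : ℤ) • weightRel ![E₀, T₁] ![(([0] : List (Fin 12)).map fun u => ((e.symm u)⁻¹).1 σ₀).toFinset, (([4, 2, 0] : List (Fin 12)).map fun u => ((e.symm u)⁻¹).1 σ₀).toFinset]) ∈
      Submodule.span ℤ {y : CMF (GalT F) conjT →₀ ℤ | ∃ g ∈ 𝒮, ∃ σ : F →+* ℂ,
        y = weightRel g.corner (fun _ => ({σ} : Finset (F →+* ℂ)))} ⊔ pairRel := by
    refine mem_of_eval_eq_comboVal Γ e hmul hconj σ₀ 𝒮 [(455, 9, 18), (455, 9, 36), (455, 9, 1152), (462, 18, 2304), (462, 36, 1152)]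
      (hreps_kept e σ₀ 𝒮 R₁ R₂ R₃ R₄ R₅ hR₁S hR₂S hR₃S hR₄S hR₅S hR₁ hR₂ hR₃ hR₄ hR₅)
      [((3619, 18, 9), 1), ((1372, 36, 576), 1), ((483, 9, 36), -1), ((3192, 2304, 576), -1), ((3605, 9, 1152), 1), ((2716, 2304, 9), -1),
        ((910, 9, 18), 1)]
      [(455, 1), (1365, 1)]
      (cells_of_check Γ _ _ checks_R₆.1) (pairs_of_check Γ _ checks_R₆.2) _ fun Ψ S hS => ?_
    rw [Finsupp.sub_apply, Finsupp.smul_apply, smul_eq_mul]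
    rw [weightRel_corner_apply Γ e hmul hconj R σ₀ hR.1 Ψ hS,
      hR.2.1,
      hR.2.2,
      weightRel_pair_apply Γ e hmul σ₀ E₀ T₁ (by norm_num) (by norm_num) hE₀ hT₁ _ _ hodgeCheck_W₁.1 Ψ hS]
    exact cert_R₆ S (code_mem_cmTypes Γ e hmul hconj hS)
  exact mem_known_of_sub_mem 𝒮 𝒲 hxy
    (zsmul_weightRel_mem_known 𝒮 𝒲 hW₁
        (isHodgeWeight_pair_of_check Γ e hmul σ₀ E₀ T₁ (by norm_num) (by norm_num) hE₀ hT₁ _ _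
          hodgeCheck_W₁.1 hodgeCheck_W₁.2.1 hodgeCheck_W₁.2.2) (-1 : ℤ))

end Model

/-! ## §3 The ENLARGED generation binder, type `ℤ/6×ℤ/2` (`c = (3,0)`), Markman column -/

/-- **The ENLARGED generation binder, type `ℤ/6×ℤ/2` (`c = (3,0)`), Markman FOURFOLD column.** `K` a Galois CM field with an enumeration
`e : GalT K ≃ Fin 12` multiplicative for b30's table with `e conjT = 3`; `σ₀` a base embedding; `𝒮` any set of faces containing faces
`R₁`, `R₂`, `R₃`, `R₄`, `R₅` READING AS `(455;9,18)`, `(455;9,36)`, `(455;9,1152)`, `(462;18,2304)`, `(462;36,1152)`; CM types `E₀`, `T₁` of `K` reading as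
`1365`, `3640`; `𝒲` any set of families containing `![E₀, T₁]`.  Then the `σ₀`-Weil character of EVERY face of `K`
lies in the subgroup generated by the Weil characters of `𝒮` and the Hodge-weight characters of `𝒲` (b23's binder `hgen_duodecicC6C2` with
the dropped faces, which exist by `FaceCensus.exists_face_reads`, eliminated through §2 at every base embedding).
[cite: Pohlmann1968, Thm. 1] [cite: Milne1999LefschetzClasses, Thm. 3.2] -/
theorem hgen_duodecicC6C2_markman (K : CMField) [IsGalois ℚ K] (e : GalT K ≃ Fin 12)
    (hmul : ∀ P Q : GalT K, e (P * Q) = Γ.mul (e P) (e Q)) (hconj : e conjT = Γ.conj) (σ₀ : (K : Type) →+* ℂ)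
    (𝒮 : Set (Face K)) (𝒲 : Set ((m : ℕ) × (Fin (m + 1) → CMType K))) (R₁ R₂ R₃ R₄ R₅ : Face K)
    (hR₁S : R₁ ∈ 𝒮) (hR₁ : (∀ P : GalT K, P.1 σ₀ ∈ R₁.Φ.1 ↔ mem (e P) 455 = true) ∧
      Γ.placeMask (e (translate σ₀ R₁.p)) = 9 ∧ Γ.placeMask (e (translate σ₀ R₁.p')) = 18)
    (hR₂S : R₂ ∈ 𝒮) (hR₂ : (∀ P : GalT K, P.1 σ₀ ∈ R₂.Φ.1 ↔ mem (e P) 455 = true) ∧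
      Γ.placeMask (e (translate σ₀ R₂.p)) = 9 ∧ Γ.placeMask (e (translate σ₀ R₂.p')) = 36)
    (hR₃S : R₃ ∈ 𝒮) (hR₃ : (∀ P : GalT K, P.1 σ₀ ∈ R₃.Φ.1 ↔ mem (e P) 455 = true) ∧
      Γ.placeMask (e (translate σ₀ R₃.p)) = 9 ∧ Γ.placeMask (e (translate σ₀ R₃.p')) = 1152)
    (hR₄S : R₄ ∈ 𝒮) (hR₄ : (∀ P : GalT K, P.1 σ₀ ∈ R₄.Φ.1 ↔ mem (e P) 462 = true) ∧
      Γ.placeMask (e (translate σ₀ R₄.p)) = 18 ∧ Γ.placeMask (e (translate σ₀ R₄.p')) = 2304)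
    (hR₅S : R₅ ∈ 𝒮) (hR₅ : (∀ P : GalT K, P.1 σ₀ ∈ R₅.Φ.1 ↔ mem (e P) 462 = true) ∧
      Γ.placeMask (e (translate σ₀ R₅.p)) = 36 ∧ Γ.placeMask (e (translate σ₀ R₅.p')) = 1152)
    (E₀ T₁ : CMType K)
    (hE₀ : (∀ P : GalT K, P.1 σ₀ ∈ E₀.1 ↔ mem (e P) 1365 = true))
    (hT₁ : (∀ P : GalT K, P.1 σ₀ ∈ T₁.1 ↔ mem (e P) 3640 = true))
    (hW₁ : (⟨1, ![E₀, T₁]⟩ : (m : ℕ) × (Fin (m + 1) → CMType K)) ∈ 𝒲) (f : Face K) :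
    lefChar f.corner (fun _ => ({σ₀} : Finset ((K : Type) →+* ℂ))) ∈ AddSubgroup.closure
      {a : Asym K | (∃ g ∈ 𝒮, ∃ σ : (K : Type) →+* ℂ,
          a = lefChar g.corner (fun _ => ({σ} : Finset ((K : Type) →+* ℂ)))) ∨
        ∃ w ∈ 𝒲, ∃ (p' : ℕ) (S' : Fin (w.1 + 1) → Finset ((K : Type) →+* ℂ)),
          IsHodgeWeight w.2 p' S' ∧ a = lefChar w.2 S'} := by
  obtain ⟨R₆, hc₆, hp₆, hq₆⟩ := exists_face_reads Γ e hmul hconj σ₀ (r := (469, 9, 1152))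
    (by decide +kernel)
  have h8 := hgen_duodecicC6C2 K e hmul hconj σ₀ (insert R₆ 𝒮)
    ⟨R₁, Set.mem_insert_of_mem _ (hR₁S), hR₁⟩
    ⟨R₂, Set.mem_insert_of_mem _ (hR₂S), hR₂⟩
    ⟨R₃, Set.mem_insert_of_mem _ (hR₃S), hR₃⟩
    ⟨R₄, Set.mem_insert_of_mem _ (hR₄S), hR₄⟩
    ⟨R₅, Set.mem_insert_of_mem _ (hR₅S), hR₅⟩
    ⟨R₆, Set.mem_insert _ _, reads_of_code e σ₀ R₆.Φ hc₆, hp₆, hq₆⟩ f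
  refine ((AddSubgroup.closure_le _).mpr ?_) h8
  rintro a ⟨g, hg, σ, rfl⟩
  simp only [Set.mem_insert_iff] at hg
  rcases hg with rfl | hg'
  · exact lefChar_corner_mem_closure_known_of_weightRel_mem 𝒮 𝒲 _ σ₀
      (weightRel_R₆_mem_span_known e hmul hconj σ₀ 𝒮 𝒲 R₁ R₂ R₃ R₄ R₅ hR₁S hR₂S hR₃S hR₄S hR₅S hR₁ hR₂ hR₃ hR₄ hR₅ _ ⟨hc₆, hp₆, hq₆⟩
        E₀ T₁ hE₀ hT₁ hW₁) σ
  · exact AddSubgroup.subset_closure (Or.inl ⟨g, hg', σ, rfl⟩)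

/-! ## §4 FIELD CLOSURE from 5 face periods and the Markman fourfold column -/

/-- **FIELD CLOSURE, type `ℤ/6×ℤ/2` (`c = (3,0)`) — 5 face periods + 1 known products (headline).** `K` a Galois CM field with an
enumeration `e : GalT K ≃ Fin 12` of its Galois translates multiplicative for b30's table, `e conjT = 3`; `σ₀` a base embedding; faces
`R₁`, `R₂`, `R₃`, `R₄`, `R₅` of `K` READING AS `(455;9,18)`, `(455;9,36)`, `(455;9,1152)`, `(462;18,2304)`, `(462;36,1152)`; CM types `E₀`, `T₁` of `K` reading as
`1365`, `3640` (the `k_a`-curve types and sextic-threefold types, by code).  ONE period witness for each of the 5 faces on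
the universe of record AND the Hodge conjecture for the 1 tree products `cmProdAV K cmAbelianVarietyRealised_holds 1 ![E_a, T]` of the weights
(Weil fourfolds `E_a × T` up to isogeny and powers; supplied modulo Markman's fourfold theorem by seat b07's
`InducedCurveThreefold.hodgeConjectureFor_cmProdAV_inducedCMType_pair_of_markman` once the types are presented as induced types) imply the
Hodge conjecture, in every codimension, for every complex abelian variety dominated by a finite product of abelian varieties realising CM
types of CM fields embeddable in `K`.  (FRAMING: conditional on these 5 face periods and on `hHC₁…`; b23's landed theorem needs 6
periods; `HC_CM` is not proved.) [cite: Shimura1998, §6.2 Theorem 3 and §6.1 Corollary of Theorem 2 (pp. 41–43)] [cite: Pohlmann1968, Thm. 1]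
[cite: Milne1999LefschetzClasses, Thm. 3.2 and Cor. 4.5] [cite: MumfordAV1970, §19 Thm. 1 and p. 169] -/
theorem hodgeConjectureFor_of_avDominatedBy_isProductOf_of_facePeriods_of_hodgeConjectureFor_duodecicC6C2 (K : CMField)
    [IsGalois ℚ K] (e : GalT K ≃ Fin 12) (hmul : ∀ P Q : GalT K, e (P * Q) = Γ.mul (e P) (e Q)) (hconj : e conjT = Γ.conj)
    (σ₀ : (K : Type) →+* ℂ) (R₁ R₂ R₃ R₄ R₅ : Face K)
    (hR₁ : (∀ P : GalT K, P.1 σ₀ ∈ R₁.Φ.1 ↔ mem (e P) 455 = true) ∧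
      Γ.placeMask (e (translate σ₀ R₁.p)) = 9 ∧ Γ.placeMask (e (translate σ₀ R₁.p')) = 18)
    (hR₂ : (∀ P : GalT K, P.1 σ₀ ∈ R₂.Φ.1 ↔ mem (e P) 455 = true) ∧
      Γ.placeMask (e (translate σ₀ R₂.p)) = 9 ∧ Γ.placeMask (e (translate σ₀ R₂.p')) = 36)
    (hR₃ : (∀ P : GalT K, P.1 σ₀ ∈ R₃.Φ.1 ↔ mem (e P) 455 = true) ∧
      Γ.placeMask (e (translate σ₀ R₃.p)) = 9 ∧ Γ.placeMask (e (translate σ₀ R₃.p')) = 1152)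
    (hR₄ : (∀ P : GalT K, P.1 σ₀ ∈ R₄.Φ.1 ↔ mem (e P) 462 = true) ∧
      Γ.placeMask (e (translate σ₀ R₄.p)) = 18 ∧ Γ.placeMask (e (translate σ₀ R₄.p')) = 2304)
    (hR₅ : (∀ P : GalT K, P.1 σ₀ ∈ R₅.Φ.1 ↔ mem (e P) 462 = true) ∧
      Γ.placeMask (e (translate σ₀ R₅.p)) = 36 ∧ Γ.placeMask (e (translate σ₀ R₅.p')) = 1152)
    (E₀ T₁ : CMType K)
    (hE₀ : (∀ P : GalT K, P.1 σ₀ ∈ E₀.1 ↔ mem (e P) 1365 = true))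
    (hT₁ : (∀ P : GalT K, P.1 σ₀ ∈ T₁.1 ↔ mem (e P) 3640 = true))
    (hHC₁ : HodgeConjectureFor (cmProdAV K cmAbelianVarietyRealised_holds 1 ![E₀, T₁]).dim
      (cmProdAV K cmAbelianVarietyRealised_holds 1 ![E₀, T₁]).X)
    (h₁ : ∃ ι₁ : K →+* ℂ, R₁.Admissible ι₁ ∧ ∃ (V : HermSpace3 K ι₁) (σ : K →+* ℂ),
      (Model.picardCMUniverse exists_isReal_hodgeModel_holds hodgePQ_independent_of_hodgeModel_holds
        BallQuotient.ballQuotientUniformised_holds cmAbelianVarietyRealised_holds).PeriodNV ι₁ V K R₁.psi σ)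
    (h₂ : ∃ ι₁ : K →+* ℂ, R₂.Admissible ι₁ ∧ ∃ (V : HermSpace3 K ι₁) (σ : K →+* ℂ),
      (Model.picardCMUniverse exists_isReal_hodgeModel_holds hodgePQ_independent_of_hodgeModel_holds
        BallQuotient.ballQuotientUniformised_holds cmAbelianVarietyRealised_holds).PeriodNV ι₁ V K R₂.psi σ)
    (h₃ : ∃ ι₁ : K →+* ℂ, R₃.Admissible ι₁ ∧ ∃ (V : HermSpace3 K ι₁) (σ : K →+* ℂ),
      (Model.picardCMUniverse exists_isReal_hodgeModel_holds hodgePQ_independent_of_hodgeModel_holds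
        BallQuotient.ballQuotientUniformised_holds cmAbelianVarietyRealised_holds).PeriodNV ι₁ V K R₃.psi σ)
    (h₄ : ∃ ι₁ : K →+* ℂ, R₄.Admissible ι₁ ∧ ∃ (V : HermSpace3 K ι₁) (σ : K →+* ℂ),
      (Model.picardCMUniverse exists_isReal_hodgeModel_holds hodgePQ_independent_of_hodgeModel_holds
        BallQuotient.ballQuotientUniformised_holds cmAbelianVarietyRealised_holds).PeriodNV ι₁ V K R₄.psi σ)
    (h₅ : ∃ ι₁ : K →+* ℂ, R₅.Admissible ι₁ ∧ ∃ (V : HermSpace3 K ι₁) (σ : K →+* ℂ),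
      (Model.picardCMUniverse exists_isReal_hodgeModel_holds hodgePQ_independent_of_hodgeModel_holds
        BallQuotient.ballQuotientUniformised_holds cmAbelianVarietyRealised_holds).PeriodNV ι₁ V K R₅.psi σ)
    {P A : AbelianVariety ℂ} (hP : AbelianVariety.IsProductOf (fun B : AbelianVariety ℂ =>
      ∃ (E : Type) (_ : Field E) (_ : NumberField E) (_ : IsCMField E) (_ : E →+* (K : Type)) (Φ : CMType E)
        (ι : 𝓞 E →+* End B) (θ : E →+* Module.End ℂ (complexBetti B.X 1)),
        IsCMTypeRealisation Φ B ι θ) P)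
    (hA : AVDominatedBy A P) : HodgeConjectureFor A.dim A.X :=
  hodgeConjectureFor_of_avDominatedBy_isProductOf_of_exists_facePeriod_of_hodgeConjectureFor_on K
    ((show 6 ≤ 12 by decide).trans_eq (FaceCensus.eq_finrank_of_enum e)) {R₁, R₂, R₃, R₄, R₅}
    {(⟨1, ![E₀, T₁]⟩ : (m : ℕ) × (Fin (m + 1) → CMType K))}
    (fun w hw => by
      rw [Set.mem_singleton_iff] at hw
      subst hw
      exact hHC₁) σ₀
    (hgen_duodecicC6C2_markman K e hmul hconj σ₀ {R₁, R₂, R₃, R₄, R₅} _ R₁ R₂ R₃ R₄ R₅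
      (by simp) hR₁ (by simp) hR₂ (by simp) hR₃ (by simp) hR₄ (by simp) hR₅
      E₀ T₁ hE₀ hT₁
      (by simp))
    (fun f hf => by
      simp only [Set.mem_insert_iff, Set.mem_singleton_iff] at hf
      rcases hf with rfl | rfl | rfl | rfl | rfl
      · exact h₁
      · exact h₂
      · exact h₃
      · exact h₄
      · exact h₅) hP hA

end Summit.HodgeConjecture.CorCM.DuodecicFaceTransport.C6C2Markman

end
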